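import Mathlib
import Summits.PneNP.PneNP.Theorems.SfmBlBlockDisc

/-!
# Reduction of discrepancy to connected pairs (component reduction, graph half) — line «sfm-bl»

FRONTIER F-N1c; nothing here bears on P vs NP.

PROOF-SFM-BL Lemma 3: if a rectangular real matrix `M` (signed biadjacency of a bipartite multigraph with
underlying simple graph `G` on `α ⊕ β`) satisfies the discrepancy bound `|uᵀMv| ≤ γ√(|u||v|)` for every 0/1
pair `(u, v)` whose joint support induces a CONNECTED subgraph of `G`, then it satisfies it for every 0/1
pair.  Proof: split `(u, v)` along the connected components of `G` restricted to the joint support; `M`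
vanishes across components; each piece is a connected pair; Cauchy–Schwarz (`SfmBl.sum_sqrt_mul_le`).
`disc_of_blockwise_pieces` is the analytic step with hypotheses only on the pieces of the given pair
(the landed `disc_of_blockwise` asks the bound for all pairs inside a block, which is more than connected
pairs supply); `disc_of_connected_pairs` is the graph statement.
-/

namespace Summit.PneNP.PneNP.Theorems.SfmBl

open Matrix Finset BigOperators

/-- Block-additivity of discrepancy, piecewise form: labels `p, q`; `M i j = 0` whenever `u i ≠ 0`, `v j ≠ 0`
and the labels differ; the bound is assumed only for the pieces `(u·1_{p=c}, v·1_{q=c})` of the given pair. -/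
theorem disc_of_blockwise_pieces {α β κ : Type*} [Fintype α] [Fintype β] [Fintype κ] [DecidableEq κ]
    (M : Matrix α β ℝ) (u : α → ℝ) (v : β → ℝ) (p : α → κ) (q : β → κ)
    (hM : ∀ i j, u i ≠ 0 → v j ≠ 0 → p i ≠ q j → M i j = 0) {γ : ℝ} (hγ : 0 ≤ γ)
    (hu : ∀ i, u i = 0 ∨ u i = 1) (hv : ∀ j, v j = 0 ∨ v j = 1)
    (h : ∀ c : κ,
      |(fun i => if p i = c then u i else 0) ⬝ᵥ (M *ᵥ (fun j => if q j = c then v j else 0))|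
        ≤ γ * Real.sqrt ((∑ i, (if p i = c then u i else 0)) * (∑ j, (if q j = c then v j else 0)))) :
    |u ⬝ᵥ (M *ᵥ v)| ≤ γ * Real.sqrt ((∑ i, u i) * (∑ j, v j)) := by
  classical
  let uc : κ → α → ℝ := fun c i => if p i = c then u i else 0
  let vc : κ → β → ℝ := fun c j => if q j = c then v j else 0
  have huc01 : ∀ c i, uc c i = 0 ∨ uc c i = 1 := by
    intro c i; by_cases hp : p i = c
    · simpa [uc, hp] using hu i
    · simp [uc, hp]
  have hvc01 : ∀ c j, vc c j = 0 ∨ vc c j = 1 := by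
    intro c j; by_cases hq : q j = c
    · simpa [vc, hq] using hv j
    · simp [vc, hq]
  -- (1) the bilinear form splits along the blocks
  have hexp : u ⬝ᵥ (M *ᵥ v) = ∑ c, (uc c) ⬝ᵥ (M *ᵥ (vc c)) := by
    have key : ∀ i j, u i * (M i j * v j) = ∑ c, uc c i * (M i j * vc c j) := by
      intro i j
      have : ∀ c, uc c i * (M i j * vc c j)
          = if p i = c then u i * (M i j * (if q j = c then v j else 0)) else 0 := by
        intro c; by_cases hp : p i = c <;> simp [uc, vc, hp]
      simp only [this, Finset.sum_ite_eq, Finset.mem_univ, if_true]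
      by_cases hpq : q j = p i
      · simp [hpq]
      · by_cases hui : u i = 0
        · simp [hui]
        · by_cases hvj : v j = 0
          · simp [hvj]
          · have hz : M i j = 0 := hM i j hui hvj (fun h' => hpq h'.symm)
            simp [hz]
    calc u ⬝ᵥ (M *ᵥ v) = ∑ i, ∑ j, u i * (M i j * v j) := by
          simp only [dotProduct, Matrix.mulVec, Finset.mul_sum]
      _ = ∑ i, ∑ j, ∑ c, uc c i * (M i j * vc c j) :=
          Finset.sum_congr rfl fun i _ => Finset.sum_congr rfl fun j _ => key i j
      _ = ∑ i, ∑ c, ∑ j, uc c i * (M i j * vc c j) :=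
          Finset.sum_congr rfl fun i _ => Finset.sum_comm
      _ = ∑ c, ∑ i, ∑ j, uc c i * (M i j * vc c j) := Finset.sum_comm
      _ = ∑ c, (uc c) ⬝ᵥ (M *ᵥ (vc c)) := by
          simp only [dotProduct, Matrix.mulVec, Finset.mul_sum]
  -- (2) block sizes add up
  have husum : ∑ c, ∑ i, uc c i = ∑ i, u i := by
    rw [Finset.sum_comm]
    refine Finset.sum_congr rfl fun i _ => ?_
    have : ∀ c, uc c i = if p i = c then u i else 0 := fun c => rfl
    simp only [this, Finset.sum_ite_eq, Finset.mem_univ, if_true]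
  have hvsum : ∑ c, ∑ j, vc c j = ∑ j, v j := by
    rw [Finset.sum_comm]
    refine Finset.sum_congr rfl fun j _ => ?_
    have : ∀ c, vc c j = if q j = c then v j else 0 := fun c => rfl
    simp only [this, Finset.sum_ite_eq, Finset.mem_univ, if_true]
  -- (3) nonnegativity of block sizes
  have hx : ∀ c, 0 ≤ ∑ i, uc c i := by
    intro c; refine Finset.sum_nonneg fun i _ => ?_
    rcases huc01 c i with h0 | h1
    · rw [h0]
    · rw [h1]; exact zero_le_one
  have hy : ∀ c, 0 ≤ ∑ j, vc c j := by
    intro c; refine Finset.sum_nonneg fun j _ => ?_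
    rcases hvc01 c j with h0 | h1
    · rw [h0]
    · rw [h1]; exact zero_le_one
  -- (4) assemble
  calc |u ⬝ᵥ (M *ᵥ v)| = |∑ c, (uc c) ⬝ᵥ (M *ᵥ (vc c))| := by rw [hexp]
    _ ≤ ∑ c, |(uc c) ⬝ᵥ (M *ᵥ (vc c))| := Finset.abs_sum_le_sum_abs _ _
    _ ≤ ∑ c, γ * Real.sqrt ((∑ i, uc c i) * (∑ j, vc c j)) :=
        Finset.sum_le_sum fun c _ => h c
    _ = γ * ∑ c, Real.sqrt ((∑ i, uc c i) * (∑ j, vc c j)) := by rw [Finset.mul_sum]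
    _ ≤ γ * Real.sqrt ((∑ c, ∑ i, uc c i) * (∑ c, ∑ j, vc c j)) :=
        mul_le_mul_of_nonneg_left (sum_sqrt_mul_le _ _ _ hx hy) hγ
    _ = γ * Real.sqrt ((∑ i, u i) * (∑ j, v j)) := by rw [husum, hvsum]

/-- LEMMA 3 (graph form).  `G` a simple graph on `α ⊕ β` containing the support of `M` (every non-zero entry
`M i j` is an edge `inl i — inr j`).  If `|uᵀMv| ≤ γ√(|u||v|)` holds for every 0/1 pair whose joint support
`{x | (u ⊕ v)(x) = 1}` induces a connected subgraph of `G`, then it holds for every 0/1 pair. -/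
theorem disc_of_connected_pairs {α β : Type*} [Fintype α] [Fintype β] (M : Matrix α β ℝ)
    (G : SimpleGraph (α ⊕ β)) (hG : ∀ i j, M i j ≠ 0 → G.Adj (Sum.inl i) (Sum.inr j))
    {γ : ℝ} (hγ : 0 ≤ γ)
    (h : ∀ u : α → ℝ, ∀ v : β → ℝ, (∀ i, u i = 0 ∨ u i = 1) → (∀ j, v j = 0 ∨ v j = 1) →
      (G.induce {x | Sum.elim u v x = 1}).Connected →
      |u ⬝ᵥ (M *ᵥ v)| ≤ γ * Real.sqrt ((∑ i, u i) * (∑ j, v j)))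
    (u : α → ℝ) (v : β → ℝ) (hu : ∀ i, u i = 0 ∨ u i = 1) (hv : ∀ j, v j = 0 ∨ v j = 1) :
    |u ⬝ᵥ (M *ᵥ v)| ≤ γ * Real.sqrt ((∑ i, u i) * (∑ j, v j)) := by
  classical
  -- the joint support and the graph `G` restricted to it (other vertices isolated)
  set X : Set (α ⊕ β) := {x | Sum.elim u v x = 1} with hXdef
  let GX : SimpleGraph (α ⊕ β) :=
    { Adj := fun x y => G.Adj x y ∧ x ∈ X ∧ y ∈ X
      symm := ⟨fun x y hxy => ⟨hxy.1.symm, hxy.2.2, hxy.2.1⟩⟩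
      loopless := ⟨fun x hxx => G.irrefl hxx.1⟩ }
  have hGX : ∀ x y, GX.Adj x y ↔ G.Adj x y ∧ x ∈ X ∧ y ∈ X := fun _ _ => Iff.rfl
  have hle : GX ≤ G := fun x y hxy => ((hGX x y).1 hxy).1
  -- membership in `X` propagates along `GX`-walks
  have aux : ∀ {x y : α ⊕ β}, GX.Walk x y → x ∈ X → y ∈ X := by
    intro x y w
    induction w with
    | nil => exact id
    | cons hadj _ ih => exact fun _ => ih ((hGX _ _).1 hadj).2.2
  haveI : Fintype GX.ConnectedComponent := Fintype.ofFinite _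
  refine disc_of_blockwise_pieces M u v (fun i => GX.connectedComponentMk (Sum.inl i))
    (fun j => GX.connectedComponentMk (Sum.inr j)) ?_ hγ hu hv ?_
  · -- `M` vanishes across components (restricted to the support)
    intro i j hui hvj hne
    by_contra hMij
    apply hne
    have hi : (Sum.inl i : α ⊕ β) ∈ X := by
      rcases hu i with h0 | h1
      · exact absurd h0 hui
      · simpa [hXdef] using h1
    have hj : (Sum.inr j : α ⊕ β) ∈ X := by
      rcases hv j with h0 | h1
      · exact absurd h0 hvj
      · simpa [hXdef] using h1
    exact SimpleGraph.ConnectedComponent.sound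
      (SimpleGraph.Adj.reachable ((hGX _ _).2 ⟨hG i j hMij, hi, hj⟩))
  · -- each piece is a connected pair (or trivial)
    intro c
    set uc : α → ℝ := fun i => if GX.connectedComponentMk (Sum.inl i) = c then u i else 0 with hucdef
    set vc : β → ℝ := fun j => if GX.connectedComponentMk (Sum.inr j) = c then v j else 0 with hvcdef
    have huc01 : ∀ i, uc i = 0 ∨ uc i = 1 := by
      intro i; by_cases hp : GX.connectedComponentMk (Sum.inl i) = c
      · simpa [hucdef, hp] using hu i
      · simp [hucdef, hp]
    have hvc01 : ∀ j, vc j = 0 ∨ vc j = 1 := by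
      intro j; by_cases hq : GX.connectedComponentMk (Sum.inr j) = c
      · simpa [hvcdef, hq] using hv j
      · simp [hvcdef, hq]
    by_cases hu0 : ∀ i, uc i = 0
    · have : uc = 0 := funext hu0
      rw [this, zero_dotProduct, abs_zero]
      exact mul_nonneg hγ (Real.sqrt_nonneg _)
    by_cases hv0 : ∀ j, vc j = 0
    · have : vc = 0 := funext hv0
      rw [this, Matrix.mulVec_zero, dotProduct_zero, abs_zero]
      exact mul_nonneg hγ (Real.sqrt_nonneg _)
    push Not at hu0
    obtain ⟨i₀, hi₀⟩ := hu0
    -- the anchor `inl i₀` lies in `X` and in the component `c`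
    have hc₀ : GX.connectedComponentMk (Sum.inl i₀) = c := by
      by_contra hne; exact hi₀ (by simp [hucdef, hne])
    have hu₀ : u i₀ = 1 := by
      rcases hu i₀ with h0 | h1
      · exact absurd (by simp [hucdef, h0]) hi₀
      · exact h1
    have hX₀ : (Sum.inl i₀ : α ⊕ β) ∈ X := by simpa [hXdef] using hu₀
    -- every vertex of the component `c` lies in `X`
    have hcX : ∀ x : α ⊕ β, GX.connectedComponentMk x = c → x ∈ X := by
      intro x hx
      obtain ⟨w⟩ := SimpleGraph.ConnectedComponent.exact (hc₀.trans hx.symm)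
      exact aux w hX₀
    -- the joint support of the piece is the support of the component `c`
    have hW : {x : α ⊕ β | Sum.elim uc vc x = 1} = c.supp := by
      ext x
      rw [Set.mem_setOf_eq, SimpleGraph.ConnectedComponent.mem_supp_iff]
      cases x with
      | inl i =>
          simp only [Sum.elim_inl]
          constructor
          · intro h1
            by_contra hne
            have : uc i = 0 := by simp [hucdef, hne]
            rw [this] at h1; exact zero_ne_one h1
          · intro hx
            have hiX : (Sum.inl i : α ⊕ β) ∈ X := hcX _ hx
            have : u i = 1 := by simpa [hXdef] using hiX
            simp [hucdef, hx, this]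
      | inr j =>
          simp only [Sum.elim_inr]
          constructor
          · intro h1
            by_contra hne
            have : vc j = 0 := by simp [hvcdef, hne]
            rw [this] at h1; exact zero_ne_one h1
          · intro hx
            have hjX : (Sum.inr j : α ⊕ β) ∈ X := hcX _ hx
            have : v j = 1 := by simpa [hXdef] using hjX
            simp [hvcdef, hx, this]
    have hconnX : (GX.induce c.supp).Connected :=
      (SimpleGraph.ConnectedComponent.maximal_connected_induce_supp c).1
    have hconn : (G.induce {x : α ⊕ β | Sum.elim uc vc x = 1}).Connected := by
      rw [hW]
      exact hconnX.mono (fun x y hxy => hle (SimpleGraph.induce_adj.1 hxy))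
    exact h uc vc huc01 hvc01 hconn

end Summit.PneNP.PneNP.Theorems.SfmBl
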